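import Literature.AlgebraicGeometry.Resolution.LogRegularCompleteNormal
import Literature.AlgebraicGeometry.Resolution.ReflectingSharpEmbedding
import Literature.AlgebraicGeometry.Resolution.LogRegularNormal
import HarnessLib

/-!
# Log regular local rings are normal domains — Kato 1994, Thm. (4.1), DISCHARGED

`Literature/AlgebraicGeometry/Resolution/LogRegularNormalHolds.lean`. K. Kato, *Toric singularities*,
Amer. J. Math. 116 (1994), Thm. (4.1): "Let `(X, M)` be a log. scheme satisfying (S) and assume
`(X, M)` is regular. Then the scheme `X` is Cohen–Macaulay and is normal." The tree records the
normality half for one fs chart through a Noetherian local ring as the NAMED FACT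
`Kato1994_logRegularLocal_isIntegrallyClosed` (`LogRegularNormal.lean`; hypothesis of the route
`ResolutionOfSingularities/RadicialJung`, crux `CleanModelsSuffice`, and of the `DescentPerfectToAll`
line `via_picover_jung`). This file PROVES it:

* `LogChart.isIntegrallyClosed_localization_of_isLogRegularAt` — for a chart `φ : P → A` by a
  finitely generated saturated `P ⊆ ℤⁿ`, log regular at the prime `𝔭` (Kato (2.1)), the local ring
  `A_𝔭` is an integrally closed domain;
* `Kato1994_logRegularLocal_isIntegrallyClosed_holds : Kato1994_logRegularLocal_isIntegrallyClosed`.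

Proof (OURS; Kato's printed proof goes through Cohen–Macaulayness [Ho] and (7.1)): a REFLECTING
sharp embedding of `P/F` (`ReflectingSharpEmbedding`) puts the chart in d-form over a PURE
`P′ ⊆ ℕ^M` (`exists_dformData_of_isLogRegularAt'`); then `Â_𝔭 ≅ Λ⟦P′ × ℕ^d⟧/(θ)` is a direct
summand of a regular local ring, hence an integrally closed domain, and normality descends along
the faithfully flat `A_𝔭 → Â_𝔭` (`LogRegularCompleteNormal`).

References: [Kato1994] K. Kato, Toric singularities, Amer. J. Math. 116 (1994), Def. (2.1), Thm.
(3.2), Thm. (4.1).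
-/

noncomputable section

open IsLocalRing

namespace Literature.AlgebraicGeometry.Resolution

namespace LogChart

universe v

/-- **Kato 1994, Thm. (4.1) (normality): the local rings of a log regular scheme are integrally
closed domains.** For a chart `φ : P → A` by a finitely generated saturated `P ⊆ ℤⁿ`, log regular
at the prime `𝔭`, the local ring `A_𝔭` is an integrally closed domain. [cite: Kato1994, Thm. (4.1)] -/
theorem isIntegrallyClosed_localization_of_isLogRegularAt {A : Type v} [CommRing A]
    [IsNoetherianRing A] {n : ℕ} {P : AddSubmonoid (Fin n → ℤ)} (hP : P.FG)
    (hsat : ∀ (v : Fin n → ℤ) (k : ℕ), 0 < k → k • v ∈ P → v ∈ P)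
    {φ : Multiplicative P →* A} {𝔭 : Ideal A} [𝔭.IsPrime] (hreg : IsLogRegularAt P φ 𝔭) :
    IsDomain (Localization.AtPrime 𝔭) ∧ IsIntegrallyClosed (Localization.AtPrime 𝔭) := by
  obtain ⟨M, e, he, hrefl⟩ :=
    exists_isSharpEmbedding_reflecting hP (isFaceOf_faceMonoid P φ 𝔭) hsat
  obtain ⟨π, d, t, hD, -⟩ := exists_dformData_of_isLogRegularAt' hP hsat hreg he
  exact LogRegularCompleteStructure.isIntegrallyClosed_of_dform hD.fg (embMonoid_pure he hrefl)
    hD.map_zero hD.map_add hD.mem_maximalIdeal hD.param_mem hD.gen hD.rank_le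

end LogChart

universe u

/-- **Kato 1994, Thm. (4.1), normality half — the named fact
`Kato1994_logRegularLocal_isIntegrallyClosed` DISCHARGED**: a Noetherian local ring `R` carrying an
fs chart `φ : P → (R, ·)` (`P ⊆ ℤⁿ` finitely generated, saturated, spanning) which is log regular
at the closed point (Kato (2.1), `LogChart.IsLogRegularLocal`) is an integrally closed domain.
(`R ≅ R_𝔪` and log regularity at the closed point is `IsLogRegularAt` at `𝔪`.)
[cite: Kato1994, Thm. (4.1)] -/
theorem Kato1994_logRegularLocal_isIntegrallyClosed_holds :
    Kato1994_logRegularLocal_isIntegrallyClosed.{u} := by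
  intro R _ _ _ n P φ hP hNS hspan hloc
  have hsat : ∀ (v : Fin n → ℤ) (k : ℕ), 0 < k → k • v ∈ P → v ∈ P :=
    fun v k hk hkv => (hNS hkv).resolve_left hk.ne'
  -- `R ≅ R_𝔪`
  have H : (maximalIdeal R).primeCompl ≤ IsUnit.submonoid R := fun x hx =>
    of_not_not fun h => hx (mem_nonunits_iff.2 h)
  let e : R ≃ₐ[R] Localization.AtPrime (maximalIdeal R) :=
    IsLocalization.atUnits R (maximalIdeal R).primeCompl H
  have he : e.toRingEquiv.toMonoidHom.comp φ =
      (algebraMap R (Localization.AtPrime (maximalIdeal R))).toMonoidHom.comp φ :=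
    MonoidHom.ext fun _ => rfl
  have hreg : LogChart.IsLogRegularAt P φ (maximalIdeal R) := by
    rw [LogChart.isLogRegularAt_iff_isLogRegularLocal, ← he,
      LogChart.isLogRegularLocal_comp_equiv]
    exact hloc
  obtain ⟨hdom, hic⟩ := LogChart.isIntegrallyClosed_localization_of_isLogRegularAt hP hsat hreg
  haveI := hdom
  haveI := hic
  exact ⟨e.toRingEquiv.injective.isDomain e.toRingEquiv.toRingHom,
    IsIntegrallyClosed.of_equiv (R := Localization.AtPrime (maximalIdeal R)) e.toRingEquiv.symm⟩

end Literature.AlgebraicGeometry.Resolution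

end
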